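import Summits.Ventures.LatticeQCDFlow.Exactness.NCMCGeneralSpaceReplicaTStatisticTwoReplicas
import HarnessLib

/-!
# Wedge probabilities of the standard Gaussian pair: `P{z₁(z₁ + cz₂) < 0} = (1/π)·arctan c`,
# `P{(z₁ + c₁z₂)(z₁ − c₂z₂) < 0} = (arctan c₁ + arctan c₂)/π`, null lines, and the product-Gaussian bookkeeping

HONEST FRAMING: exact (Metropolis-corrected) sampling algorithms for lattice gauge theory;
figures of merit are autocorrelation/cost numbers at stated couplings and volumes; no
continuum-physics claim.  (SCALAR calibration rung S0-A: not a gauge result.)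

Venture `LatticeQCDFlow` (cell pub-lqcd), topic `Exactness`; FANOUT row 2 (`s0-phi4`; the
battery's exact free-field checks).  NEW WORK of the cell — the shared toolbox of the two exact
free-field acceptance laws of this generation (`GaussianMetropolisSiteAcceptance`: local arm,
`ā = (2/π)·arctan(2√a/√v)`; `FreeFieldHMCModeAcceptance`: HMC arm, `ā = 1 − (2/π)·arctan √(⟨ΔH⟩/2)`),
built on row 13's polar-coordinate cone lemma `GeneralNCMC.gaussianReal_prod_measure_abs_le_mul_abs`
(`(N(0,1) ⊗ N(0,1)){|z₁| ≤ q|z₂|} = (2/π)·arctan q`) and Mathlib's Gaussian push-forwards.  Nothing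
is cited as a fact; no definition.  Elementary plane geometry for a rotation-invariant law, typed
WITHOUT rotations: an open wedge of angle `ψ` adjacent to an axis and its mirror image tile a
symmetric double cone up to the null axis, whence `P(wedge) = ψ/π`; two wedges on opposite sides of
the axis add.

## What is proved

* §1 (`a v : ℝ≥0`, both `≠ 0`; pair density `p_v(x) p_a(y)` on `ℝ × ℝ`): `exp_neg_rwEnergy`
  (`e^{−(−log p_v − log p_a)} = p_v p_a`), `integral_ite_mul_stepTarget_prod` (weighted indicator
  integrals are `(N(0,v) ⊗ N(0,a))`-probabilities), `stepTarget_prod_eq_map` (the pair law is the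
  image of `N(0,1) ⊗ N(0,1)` under `(z₁,z₂) ↦ (√v z₁, √a z₂)`);
* §2 (`P = N(0,1) ⊗ N(0,1)`): `stdGaussianProd_axis_null` (`P{z₁ = 0} = 0`),
  `stdGaussianProd_line_null` (`P{z₁ + cz₂ = 0} = 0`, `c ≠ 0`), **`stdGaussianProd_real_wedge`**
  (`P{z₁(z₁ + cz₂) < 0} = (1/π)·arctan c`, `c > 0`), `stdGaussianProd_real_wedge_neg` (mirror),
  **`stdGaussianProd_real_twoLineWedge`** (`P{(z₁ + c₁z₂)(z₁ − c₂z₂) < 0} = (arctan c₁ + arctan c₂)/π`,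
  `c₁, c₂ > 0`), **`stdGaussianProd_real_twoLineWedge'`** (general position `k ≠ 0`, `a < 0 < b`:
  `P{(kz₁ + az₂)(kz₁ + bz₂) < 0} = (arctan(−a/|k|) + arctan(b/|k|))/π`),
  `stdGaussianProd_real_twoLineWedge_le_eq_lt` (the closed wedge has the same probability: ties are
  two null lines).

NOT CLAIMED: rotation invariance of the pair law as such (not needed); wedges bounded by two lines
on the same side of the axis (a difference of two axis wedges — not needed here); any value.
-/

namespace Summit.Ventures.LatticeQCDFlow.Exactness

open Real MeasureTheory ProbabilityTheory Filter Set
open scoped NNReal ENNReal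

section GaussianPair

variable {a v : ℝ≥0}

/-! ## §1 Product-Gaussian bookkeeping -/

/-- `exp(−(−log p_v(x) − log p_a(y))) = p_v(x) · p_a(y)`: the pair density as a Boltzmann weight. -/
theorem exp_neg_rwEnergy (ha : a ≠ 0) (hv : v ≠ 0) (p : ℝ × ℝ) :
    Real.exp (-(-Real.log (gaussianPDFReal 0 v p.1) - Real.log (gaussianPDFReal 0 a p.2)))
      = gaussianPDFReal 0 v p.1 * gaussianPDFReal 0 a p.2 := by
  rw [show -(-Real.log (gaussianPDFReal 0 v p.1) - Real.log (gaussianPDFReal 0 a p.2))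
      = Real.log (gaussianPDFReal 0 v p.1) + Real.log (gaussianPDFReal 0 a p.2) by ring, Real.exp_add,
    Real.exp_log (gaussianPDFReal_pos _ _ _ hv), Real.exp_log (gaussianPDFReal_pos _ _ _ ha)]

/-- Weighted indicator integrals against `ρ_v(u) p_a(φ)` are probabilities of `N(0,v) ⊗ N(0,a)`. -/
theorem integral_ite_mul_stepTarget_prod (hv : v ≠ 0) (ha : a ≠ 0) {S : Set (ℝ × ℝ)}
    (hS : MeasurableSet S) [DecidablePred (· ∈ S)] :
    ∫ z, (if z ∈ S then (1 : ℝ) else 0) * (gaussianPDFReal 0 v z.1 * gaussianPDFReal 0 a z.2)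
        ∂((volume : Measure ℝ).prod volume)
      = (((gaussianReal 0 v).prod (gaussianReal 0 a)) S).toReal := by
  have hf : Measurable fun z : ℝ × ℝ => gaussianPDFReal 0 v z.1 * gaussianPDFReal 0 a z.2 :=
    ((measurable_gaussianPDFReal 0 v).comp measurable_fst).mul
      ((measurable_gaussianPDFReal 0 a).comp measurable_snd)
  have hf0 : ∀ z : ℝ × ℝ, 0 ≤ gaussianPDFReal 0 v z.1 * gaussianPDFReal 0 a z.2 := fun z =>
    mul_nonneg (gaussianPDFReal_nonneg _ _ _) (gaussianPDFReal_nonneg _ _ _)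
  have e : (fun z : ℝ × ℝ => (if z ∈ S then (1 : ℝ) else 0)
      * (gaussianPDFReal 0 v z.1 * gaussianPDFReal 0 a z.2))
      = S.indicator (fun z => gaussianPDFReal 0 v z.1 * gaussianPDFReal 0 a z.2) := by
    funext z
    by_cases hz : z ∈ S
    · rw [if_pos hz, indicator_of_mem hz, one_mul]
    · rw [if_neg hz, indicator_of_notMem hz, zero_mul]
  rw [e, integral_indicator hS, gaussianReal_of_var_ne_zero 0 hv, gaussianReal_of_var_ne_zero 0 ha,
    prod_withDensity (measurable_gaussianPDF 0 v) (measurable_gaussianPDF 0 a), withDensity_apply _ hS,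
    integral_eq_lintegral_of_nonneg_ae (Eventually.of_forall fun z => hf0 z)
      hf.aestronglyMeasurable.restrict]
  congr 1
  refine setLIntegral_congr_fun hS (fun z _ => ?_)
  rw [gaussianPDF, gaussianPDF, ← ENNReal.ofReal_mul (gaussianPDFReal_nonneg _ _ _)]

/-- The product Gaussian as the push-forward of the standard one: `N(0,v) ⊗ N(0,a)` is the image of
`N(0,1) ⊗ N(0,1)` under `(z₁, z₂) ↦ (√v z₁, √a z₂)`. -/
theorem stepTarget_prod_eq_map (v a : ℝ≥0) :
    (gaussianReal 0 v).prod (gaussianReal 0 a)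
      = ((gaussianReal 0 1).prod (gaussianReal 0 1)).map
          (Prod.map (fun x : ℝ => Real.sqrt (v : ℝ) * x) (fun x : ℝ => Real.sqrt (a : ℝ) * x)) := by
  have h : ∀ w : ℝ≥0, gaussianReal 0 w = (gaussianReal 0 1).map (fun x => Real.sqrt (w : ℝ) * x) := by
    intro w
    rw [gaussianReal_map_const_mul, mul_zero]
    congr 1
    apply NNReal.eq
    simp [Real.sq_sqrt w.coe_nonneg]
  rw [h v, h a, Measure.map_prod_map _ _ (measurable_const_mul (Real.sqrt (v : ℝ)))
    (measurable_const_mul (Real.sqrt (a : ℝ)))]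

end GaussianPair

/-! ## §2 Null lines and the axis-adjacent wedge under `N(0,1) ⊗ N(0,1)` -/

section Wedges

/-- The vertical axis is null for `N(0,1) ⊗ N(0,1)`. -/
theorem stdGaussianProd_axis_null :
    ((gaussianReal (0 : ℝ) 1).prod (gaussianReal (0 : ℝ) 1)) {z : ℝ × ℝ | z.1 = 0} = 0 := by
  haveI := nullSingletonClass_gaussianReal (μ := (0 : ℝ)) (v := 1) one_ne_zero
  have hset : {z : ℝ × ℝ | z.1 = 0} = ({0} : Set ℝ) ×ˢ (univ : Set ℝ) := by
    ext z; simp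
  rw [hset, Measure.prod_prod, measure_singleton, zero_mul]

/-- A non-vertical line through the origin is null for `N(0,1) ⊗ N(0,1)` (`c ≠ 0`). -/
theorem stdGaussianProd_line_null {c : ℝ} (hc : c ≠ 0) :
    ((gaussianReal (0 : ℝ) 1).prod (gaussianReal (0 : ℝ) 1)) {z : ℝ × ℝ | z.1 + c * z.2 = 0} = 0 := by
  haveI := nullSingletonClass_gaussianReal (μ := (0 : ℝ)) (v := 1) one_ne_zero
  have hm : MeasurableSet {z : ℝ × ℝ | z.1 + c * z.2 = 0} :=
    measurableSet_eq_fun (measurable_fst.add (measurable_snd.const_mul c)) measurable_const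
  rw [Measure.prod_apply hm]
  have hslice : ∀ x : ℝ, (Prod.mk x ⁻¹' {z : ℝ × ℝ | z.1 + c * z.2 = 0}) = {-x / c} := by
    intro x; ext y
    simp only [mem_preimage, mem_setOf_eq, mem_singleton_iff]
    constructor
    · intro h; field_simp; linarith
    · intro h; rw [h]; field_simp; ring
  simp_rw [hslice, measure_singleton, lintegral_zero]

/-- **THE WEDGE PROBABILITY**: for `c > 0`, under `N(0,1) ⊗ N(0,1)`,
`P{z₁(z₁ + c z₂) < 0} = (1/π)·arctan c` — the open wedge between the axis `z₁ = 0` and the line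
`z₁ + c z₂ = 0` and its mirror image `z₂ ↦ −z₂` fill the open double cone `{|z₁| < c|z₂|}` up to the
null axis, and the cone's complement `{|z₂| ≤ c⁻¹|z₁|}` is the tree's closed cone of probability
`(2/π)·arctan c⁻¹ = 1 − (2/π)·arctan c`. -/
theorem stdGaussianProd_real_wedge {c : ℝ} (hc : 0 < c) :
    ((gaussianReal (0 : ℝ) 1).prod (gaussianReal (0 : ℝ) 1)).real {z : ℝ × ℝ | z.1 * (z.1 + c * z.2) < 0}
      = 1 / π * Real.arctan c := by
  set P : Measure (ℝ × ℝ) := (gaussianReal (0 : ℝ) 1).prod (gaussianReal (0 : ℝ) 1) with hP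
  haveI : IsProbabilityMeasure P := by rw [hP]; infer_instance
  set W : Set (ℝ × ℝ) := {z | z.1 * (z.1 + c * z.2) < 0} with hW
  set W' : Set (ℝ × ℝ) := {z | z.1 * (z.1 + c * -z.2) < 0} with hW'
  set D : Set (ℝ × ℝ) := {z | |z.1| < c * |z.2|} with hD
  have hWm : MeasurableSet W :=
    measurableSet_lt (measurable_fst.mul (measurable_fst.add (measurable_snd.const_mul c))) measurable_const
  have hW'm : MeasurableSet W' :=
    measurableSet_lt (measurable_fst.mul (measurable_fst.add ((measurable_snd.neg).const_mul c)))
      measurable_const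
  have hDm : MeasurableSet D := measurableSet_lt measurable_fst.abs (measurable_snd.abs.const_mul c)
  -- the mirror wedge has the same probability (reflect the second coordinate)
  have hrefl : P.map (Prod.map id (fun y : ℝ => -y)) = P := by
    rw [hP, ← Measure.map_prod_map _ _ measurable_id measurable_neg, Measure.map_id, gaussianReal_map_neg,
      neg_zero]
  have hW'eq : P.real W' = P.real W := by
    rw [← hrefl, map_measureReal_apply (measurable_id.prodMap measurable_neg) hW'm, hrefl]
    congr 1
    ext z
    simp [hW, hW']
  -- disjoint wedges inside the open double cone …
  have hdisj : Disjoint W W' := by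
    rw [Set.disjoint_left]
    intro z h1 h2
    simp only [hW, hW', mem_setOf_eq] at h1 h2
    nlinarith [h1, h2, sq_nonneg z.1]
  have hsub : W ∪ W' ⊆ D := by
    intro z hz
    simp only [hW, hW', hD, mem_union, mem_setOf_eq] at hz ⊢
    rw [← abs_of_pos hc, ← abs_mul, ← sq_lt_sq]
    rcases hz with h | h
    · nlinarith [sq_nonneg (z.1 + c * z.2), h]
    · nlinarith [sq_nonneg (z.1 - c * z.2), h]
  -- … which they fill up to the null axis
  have hsup : D ⊆ (W ∪ W') ∪ {z : ℝ × ℝ | z.1 = 0} := by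
    intro z hz
    simp only [hW, hW', hD, mem_union, mem_setOf_eq] at hz ⊢
    by_cases h0 : z.1 = 0
    · exact Or.inr h0
    · left
      have hz1 : 0 < z.1 ^ 2 := by positivity
      have hsq : z.1 ^ 2 < (c * z.2) ^ 2 := by
        apply sq_lt_sq.mpr
        rw [abs_mul, abs_of_pos hc]
        exact hz
      by_contra hcon
      push Not at hcon
      obtain ⟨hA, hB⟩ := hcon
      nlinarith [mul_nonneg hA hB, mul_pos hz1 (sub_pos.mpr hsq)]
  have hA0 : P.real {z : ℝ × ℝ | z.1 = 0} = 0 := by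
    rw [measureReal_def, hP, stdGaussianProd_axis_null, ENNReal.toReal_zero]
  have h2 : 2 * P.real W = P.real D := by
    apply le_antisymm
    · calc 2 * P.real W = P.real W + P.real W' := by rw [hW'eq, two_mul]
        _ = P.real (W ∪ W') := (measureReal_union hdisj hW'm).symm
        _ ≤ P.real D := measureReal_mono hsub
    · calc P.real D ≤ P.real ((W ∪ W') ∪ {z : ℝ × ℝ | z.1 = 0}) := measureReal_mono hsup
        _ ≤ P.real (W ∪ W') + P.real {z : ℝ × ℝ | z.1 = 0} := measureReal_union_le _ _
        _ = P.real W + P.real W' := by rw [hA0, add_zero, measureReal_union hdisj hW'm]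
        _ = 2 * P.real W := by rw [hW'eq, two_mul]
  -- the open double cone by complement of the tree's closed cone (roles swapped)
  have hDc : P.real D = 2 / π * Real.arctan c := by
    have hc' : P.real Dᶜ = 2 / π * Real.arctan c⁻¹ := by
      have hcompl : Dᶜ = Prod.swap ⁻¹' {p : ℝ × ℝ | |p.1| ≤ c⁻¹ * |p.2|} := by
        ext z
        simp only [hD, mem_compl_iff, mem_setOf_eq, not_lt, mem_preimage, Prod.fst_swap, Prod.snd_swap]
        rw [← div_eq_inv_mul, le_div_iff₀ hc, mul_comm]
      rw [hcompl, ← map_measureReal_apply measurable_swap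
        (measurableSet_le measurable_fst.abs (measurable_snd.abs.const_mul _)), hP, Measure.prod_swap,
        measureReal_def, GeneralNCMC.gaussianReal_prod_measure_abs_le_mul_abs (inv_pos.mpr hc).le,
        ENNReal.toReal_ofReal (mul_nonneg (div_nonneg zero_le_two pi_pos.le)
          (Real.arctan_nonneg.mpr (inv_pos.mpr hc).le))]
    have h1 : P.real D = 1 - P.real Dᶜ := by
      rw [probReal_compl_eq_one_sub hDm]; ring
    rw [h1, hc', Real.arctan_inv_of_pos hc]
    field_simp
    ring
  have : P.real W = 1 / π * Real.arctan c := by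
    rw [hDc] at h2
    field_simp at h2 ⊢
    linarith
  exact this

/-- The mirror wedge: `(N(0,1)⊗N(0,1)){z₁(z₁ − c z₂) < 0} = (1/π)·arctan c` for `c > 0`
(reflect `z₂ ↦ −z₂`). -/
theorem stdGaussianProd_real_wedge_neg {c : ℝ} (hc : 0 < c) :
    ((gaussianReal (0 : ℝ) 1).prod (gaussianReal (0 : ℝ) 1)).real {z : ℝ × ℝ | z.1 * (z.1 - c * z.2) < 0}
      = 1 / π * Real.arctan c := by
  set P : Measure (ℝ × ℝ) := (gaussianReal (0 : ℝ) 1).prod (gaussianReal (0 : ℝ) 1) with hP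
  have hrefl : P.map (Prod.map id (fun y : ℝ => -y)) = P := by
    rw [hP, ← Measure.map_prod_map _ _ measurable_id measurable_neg, Measure.map_id, gaussianReal_map_neg,
      neg_zero]
  have hm : MeasurableSet {z : ℝ × ℝ | z.1 * (z.1 - c * z.2) < 0} :=
    measurableSet_lt (measurable_fst.mul (measurable_fst.sub (measurable_snd.const_mul c))) measurable_const
  rw [← hrefl, map_measureReal_apply (measurable_id.prodMap measurable_neg) hm]
  have hpre : (Prod.map id (fun y : ℝ => -y)) ⁻¹' {z : ℝ × ℝ | z.1 * (z.1 - c * z.2) < 0}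
      = {z : ℝ × ℝ | z.1 * (z.1 + c * z.2) < 0} := by
    ext z; simp [sub_neg_eq_add]
  rw [hpre, hP, stdGaussianProd_real_wedge hc]

/-- **THE TWO-LINE WEDGE**: for `c₁, c₂ > 0`, under `N(0,1) ⊗ N(0,1)`,
`P{(z₁ + c₁z₂)(z₁ − c₂z₂) < 0} = (arctan c₁ + arctan c₂)/π` — the open double wedge between the
lines `z₁ = −c₁z₂` and `z₁ = c₂z₂` (on opposite sides of the axis `z₁ = 0`) is the disjoint union of
the two axis-adjacent wedges, up to the null axis. -/
theorem stdGaussianProd_real_twoLineWedge {c₁ c₂ : ℝ} (hc₁ : 0 < c₁) (hc₂ : 0 < c₂) :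
    ((gaussianReal (0 : ℝ) 1).prod (gaussianReal (0 : ℝ) 1)).real
        {z : ℝ × ℝ | (z.1 + c₁ * z.2) * (z.1 - c₂ * z.2) < 0}
      = (Real.arctan c₁ + Real.arctan c₂) / π := by
  set P : Measure (ℝ × ℝ) := (gaussianReal (0 : ℝ) 1).prod (gaussianReal (0 : ℝ) 1) with hP
  haveI : IsProbabilityMeasure P := by rw [hP]; infer_instance
  set T : Set (ℝ × ℝ) := {z | (z.1 + c₁ * z.2) * (z.1 - c₂ * z.2) < 0} with hT
  set W₁ : Set (ℝ × ℝ) := {z | z.1 * (z.1 + c₁ * z.2) < 0} with hW₁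
  set W₂ : Set (ℝ × ℝ) := {z | z.1 * (z.1 - c₂ * z.2) < 0} with hW₂
  have hW₂m : MeasurableSet W₂ :=
    measurableSet_lt (measurable_fst.mul (measurable_fst.sub (measurable_snd.const_mul c₂))) measurable_const
  have hdisj : Disjoint W₁ W₂ := by
    rw [Set.disjoint_left]
    intro z h1 h2
    simp only [hW₁, hW₂, mem_setOf_eq] at h1 h2
    -- `c₂·[z₁(z₁ + c₁z₂)] + c₁·[z₁(z₁ − c₂z₂)] = (c₁ + c₂) z₁² ≥ 0`
    nlinarith [mul_nonneg (add_pos hc₁ hc₂).le (sq_nonneg z.1), h1, h2, hc₁, hc₂]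
  have hsub : W₁ ∪ W₂ ⊆ T := by
    intro z hz
    simp only [hW₁, hW₂, hT, mem_union, mem_setOf_eq] at hz ⊢
    rcases hz with h | h
    · -- `z₁ + c₁z₂` opposite in sign to `z₁`, and `z₁ − c₂z₂ = ((c₁+c₂)z₁ − c₂(z₁ + c₁z₂))/c₁` has the sign of `z₁`
      nlinarith [h, sq_nonneg (z.1 + c₁ * z.2), sq_nonneg z.1, mul_pos hc₁ hc₂,
        mul_nonneg hc₂.le (sq_nonneg (z.1 + c₁ * z.2))]
    · nlinarith [h, sq_nonneg (z.1 - c₂ * z.2), sq_nonneg z.1, mul_pos hc₁ hc₂,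
        mul_nonneg hc₁.le (sq_nonneg (z.1 - c₂ * z.2))]
  have hsup : T ⊆ (W₁ ∪ W₂) ∪ {z : ℝ × ℝ | z.1 = 0} := by
    intro z hz
    simp only [hW₁, hW₂, hT, mem_union, mem_setOf_eq] at hz ⊢
    by_cases h0 : z.1 = 0
    · exact Or.inr h0
    · left
      by_contra hcon
      push Not at hcon
      obtain ⟨hA, hB⟩ := hcon
      -- both `z₁(z₁ + c₁z₂) ≥ 0` and `z₁(z₁ − c₂z₂) ≥ 0`; their product is `z₁²·T(z) < 0`
      have hz1 : 0 < z.1 ^ 2 := by positivity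
      nlinarith [mul_nonneg hA hB, mul_pos hz1 (neg_pos.mpr hz)]
  have hA0 : P.real {z : ℝ × ℝ | z.1 = 0} = 0 := by
    rw [measureReal_def, hP, stdGaussianProd_axis_null, ENNReal.toReal_zero]
  have h1 : P.real W₁ = 1 / π * Real.arctan c₁ := by rw [hP]; exact stdGaussianProd_real_wedge hc₁
  have h2 : P.real W₂ = 1 / π * Real.arctan c₂ := by rw [hP]; exact stdGaussianProd_real_wedge_neg hc₂
  have hTeq : P.real T = P.real W₁ + P.real W₂ := by
    apply le_antisymm
    · calc P.real T ≤ P.real ((W₁ ∪ W₂) ∪ {z : ℝ × ℝ | z.1 = 0}) := measureReal_mono hsup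
        _ ≤ P.real (W₁ ∪ W₂) + P.real {z : ℝ × ℝ | z.1 = 0} := measureReal_union_le _ _
        _ = P.real W₁ + P.real W₂ := by rw [hA0, add_zero, measureReal_union hdisj hW₂m]
    · calc P.real W₁ + P.real W₂ = P.real (W₁ ∪ W₂) := (measureReal_union hdisj hW₂m).symm
        _ ≤ P.real T := measureReal_mono hsub
  rw [hTeq, h1, h2]
  ring

/-- **General position**: for `k ≠ 0` and `a < 0 < b`,
`P{(k z₁ + a z₂)(k z₁ + b z₂) < 0} = (arctan(−a/|k|) + arctan(b/|k|))/π`. -/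
theorem stdGaussianProd_real_twoLineWedge' {k a b : ℝ} (hk : k ≠ 0) (ha : a < 0) (hb : 0 < b) :
    ((gaussianReal (0 : ℝ) 1).prod (gaussianReal (0 : ℝ) 1)).real
        {z : ℝ × ℝ | (k * z.1 + a * z.2) * (k * z.1 + b * z.2) < 0}
      = (Real.arctan (-a / |k|) + Real.arctan (b / |k|)) / π := by
  have hk2 : 0 < k ^ 2 := by positivity
  rcases lt_or_gt_of_ne hk with hneg | hpos
  · -- `k < 0`: `(k z₁ + a z₂)(k z₁ + b z₂) = k²·(z₁ + (a/k) z₂)(z₁ − (−b/k) z₂)`, `a/k > 0`, `−b/k > 0`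
    have hc₁ : 0 < a / k := div_pos_of_neg_of_neg ha hneg
    have hc₂ : 0 < -b / k := div_pos_of_neg_of_neg (neg_neg_of_pos hb) hneg
    have hset : {z : ℝ × ℝ | (k * z.1 + a * z.2) * (k * z.1 + b * z.2) < 0}
        = {z : ℝ × ℝ | (z.1 + a / k * z.2) * (z.1 - -b / k * z.2) < 0} := by
      ext z
      simp only [mem_setOf_eq]
      have e : (k * z.1 + a * z.2) * (k * z.1 + b * z.2)
          = k ^ 2 * ((z.1 + a / k * z.2) * (z.1 - -b / k * z.2)) := by
        field_simp
        ring
      rw [e]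
      constructor
      · intro h; nlinarith [h, hk2]
      · intro h; nlinarith [h, hk2]
    rw [hset, stdGaussianProd_real_twoLineWedge hc₁ hc₂, abs_of_neg hneg, neg_div_neg_eq, div_neg,
      neg_div]
  · have hc₁ : 0 < b / k := div_pos hb hpos
    have hc₂ : 0 < -a / k := div_pos (neg_pos.mpr ha) hpos
    have hset : {z : ℝ × ℝ | (k * z.1 + a * z.2) * (k * z.1 + b * z.2) < 0}
        = {z : ℝ × ℝ | (z.1 + b / k * z.2) * (z.1 - -a / k * z.2) < 0} := by
      ext z
      simp only [mem_setOf_eq]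
      have e : (k * z.1 + a * z.2) * (k * z.1 + b * z.2)
          = k ^ 2 * ((z.1 + b / k * z.2) * (z.1 - -a / k * z.2)) := by
        field_simp
        ring
      rw [e]
      constructor
      · intro h; nlinarith [h, hk2]
      · intro h; nlinarith [h, hk2]
    rw [hset, stdGaussianProd_real_twoLineWedge hc₁ hc₂, abs_of_pos hpos, add_comm]

/-- **Ties are null**: the closed double wedge has the same probability as the open one
(`k, a, b ≠ 0`: the boundary is two lines through the origin). -/
theorem stdGaussianProd_real_twoLineWedge_le_eq_lt {k a b : ℝ} (hk : k ≠ 0) (ha : a ≠ 0) (hb : b ≠ 0) :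
    ((gaussianReal (0 : ℝ) 1).prod (gaussianReal (0 : ℝ) 1)).real
        {z : ℝ × ℝ | (k * z.1 + a * z.2) * (k * z.1 + b * z.2) ≤ 0}
      = ((gaussianReal (0 : ℝ) 1).prod (gaussianReal (0 : ℝ) 1)).real
        {z : ℝ × ℝ | (k * z.1 + a * z.2) * (k * z.1 + b * z.2) < 0} := by
  set P : Measure (ℝ × ℝ) := (gaussianReal (0 : ℝ) 1).prod (gaussianReal (0 : ℝ) 1) with hP
  set L₁ : Set (ℝ × ℝ) := {z | z.1 + a / k * z.2 = 0} with hL₁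
  set L₂ : Set (ℝ × ℝ) := {z | z.1 + b / k * z.2 = 0} with hL₂
  have hnull : P.real (L₁ ∪ L₂) = 0 := by
    apply le_antisymm _ measureReal_nonneg
    calc P.real (L₁ ∪ L₂) ≤ P.real L₁ + P.real L₂ := measureReal_union_le _ _
      _ = 0 := by
          rw [measureReal_def, measureReal_def, hP, hL₁, hL₂, stdGaussianProd_line_null (div_ne_zero ha hk),
            stdGaussianProd_line_null (div_ne_zero hb hk)]
          simp
  have hcov : {z : ℝ × ℝ | (k * z.1 + a * z.2) * (k * z.1 + b * z.2) ≤ 0}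
      ⊆ {z : ℝ × ℝ | (k * z.1 + a * z.2) * (k * z.1 + b * z.2) < 0} ∪ (L₁ ∪ L₂) := by
    intro z hz
    simp only [hL₁, hL₂, mem_setOf_eq, mem_union] at hz ⊢
    rcases hz.lt_or_eq with h | h
    · exact Or.inl h
    · right
      rcases mul_eq_zero.mp h with h1 | h1
      · left; field_simp; linarith
      · right; field_simp; linarith
  apply le_antisymm
  · calc P.real {z : ℝ × ℝ | (k * z.1 + a * z.2) * (k * z.1 + b * z.2) ≤ 0}
        ≤ P.real ({z : ℝ × ℝ | (k * z.1 + a * z.2) * (k * z.1 + b * z.2) < 0} ∪ (L₁ ∪ L₂)) :=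
          measureReal_mono hcov
      _ ≤ P.real {z : ℝ × ℝ | (k * z.1 + a * z.2) * (k * z.1 + b * z.2) < 0} + P.real (L₁ ∪ L₂) :=
          measureReal_union_le _ _
      _ = _ := by rw [hnull, add_zero]
  · exact measureReal_mono fun z hz => le_of_lt (by simpa only [mem_setOf_eq] using hz)

end Wedges

end Summit.Ventures.LatticeQCDFlow.Exactness
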